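import Literature.MathematicalPhysics.KineticTheory.InfiniteChainGibbsScaling
import HarnessLib

/-!
# Amplitude scaling of the infinite pinned chain, II: dynamics, currents and Green–Kubo objects

Topic `Literature/MathematicalPhysics/KineticTheory`; sibling of `InfiniteChainGibbsScaling.lean`
(the DLR half). Everything here is PROVED; no named fact is introduced. (Re-derivation, by the
cycle-2 crux disprover of `stmt-AtomisticToContinuum-12597`, of the bounced proposal p68965 whose
text was not recoverable; statements follow its evidence note.)

## The statement (Aoki–Lukkarinen–Spohn 2006, §2, infinite-volume dynamical form)

ALS (J. Stat. Phys. 124, arXiv:cond-mat/0602082), §2 eqs. (2.8)–(2.12): the amplitude change of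
variables maps solutions of the anharmonic pinned chain to solutions with rescaled couplings and
`κ(T, ω₀, δ, λ) = α⁻¹ κ(α²γ²T, αω₀, δ, α²γ⁻²λ)` (2.12), "the conductivity depends on the anharmonic
coupling and the temperature only through `λT`" (2.13). For the tree's family
`pinnedChain ω₂ lam β γ` (`U = ω₂q²/2 + lam q⁴/4`, `V = r²/2 + βr⁴/4`) and the pure amplitude
dilation `S_s σ = s • σ` (no time change):

* `force_smul`: `F^{lam,β}_i(s • σ) = s · F^{lam s²,β s²}_i(σ)`; `isSolution_smul_iff`: `t ↦ s • c t`
  solves the `(lam, β)` equations iff `c` solves the `(lam s², β s²)` equations (`s ≠ 0`);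
* `smulDynamics`: an `InfiniteChainDynamics` of `pinnedChain ω₂ (lam s²) (β s²) γ` conjugates to
  one of `pinnedChain ω₂ lam β γ` (carrier `S_s '' carrier`, flow `S_s ∘ φ_t ∘ S_s⁻¹`, uniqueness
  field included);
* `bondCurrentZ_smul` (`j ↦ s² j'`), `currentCorrelation_smulDynamics` (`C = s⁴ C'` in the
  push-forward state), `hasAbsConvergentCorrelation_smulDynamics_iff`,
  `preservesMeasure_smulDynamics`, `abelFunctional_smul` (`((s²T)²)⁻¹∫e^{-νt}C = (T²)⁻¹∫e^{-νt}C'`),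
  `greenKuboConductivity_smulDynamics`, `hasGreenKubo_smulDynamics_iff`;
* the two existence-level corollaries used by the theses of `AtomisticToContinuum/FouriersLaw`:
  `exists_abelWitness_iff_unit_temp` (the Abelian Green–Kubo witness of
  `EmbeddedDrudeMourre.GreenKuboContinuation` / `AbelThermodynamicLimit` at `(lam, β; T)` ⇔ at
  `(lam T, β T; 1)`, SAME `κ`) and `exists_hasGreenKubo_iff_unit_temp` (the clause of
  `FourierGreenKubo.FourierGreenKubo`, stmt-0703): LOW TEMPERATURE IS WEAK ANHARMONICITY for the
  infinite closed chain.

## Design notes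

* The dilation is `dilEquiv hs` of the sibling file (`MeasurableEquiv.smul₀`); states transport by
  `μ.map (dilEquiv hs)`; the inverse direction of every `iff` is obtained from the forward one at
  `s⁻¹` (`map_dilEquiv_map_dilEquiv_inv`), as in the DLR file.
* `U'`, `V'` of `pinnedChain` enter through `HasDerivAt` one-liners (`AmplitudeScaling.hasDerivAt_U/_V`)
  rather than the `deriv` lemmas of `LangevinChainSDE` / `LangevinChainNESSProofs`, to keep this
  cone free of the Langevin-SDE cone (same policy as the DLR sibling).
-/

noncomputable section

open MeasureTheory Filter Set Topology
open scoped ENNReal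
open Literature.Probability.LatticeModels

namespace Literature.MathematicalPhysics.KineticTheory.HeatConduction

namespace AmplitudeScaling

/-- `U` of `pinnedChain` has derivative `ω₂ q + lam q³` (stated as `HasDerivAt`; the `deriv` form
is `pinnedChain_deriv_U` of `LangevinChainSDE`, not imported to keep this cone SDE-free).
[folklore] -/
theorem hasDerivAt_U (ω₂ lam β γ q : ℝ) :
    HasDerivAt (pinnedChain ω₂ lam β γ).U (ω₂ * q + lam * q ^ 3) q := by
  have h : HasDerivAt (fun q : ℝ => ω₂ * q ^ 2 / 2 + lam * q ^ 4 / 4)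
      (ω₂ * (2 * q ^ 1 * 1) / 2 + lam * (4 * q ^ 3 * 1) / 4) q :=
    ((((hasDerivAt_id q).pow 2).const_mul ω₂).div_const 2).add
      ((((hasDerivAt_id q).pow 4).const_mul lam).div_const 4)
  have e : ω₂ * (2 * q ^ 1 * 1) / 2 + lam * (4 * q ^ 3 * 1) / 4 = ω₂ * q + lam * q ^ 3 := by ring
  rw [e] at h
  exact h

/-- `V` of `pinnedChain` has derivative `r + β r³` (`HasDerivAt` form; cf. `pinnedChain_deriv_V`
of `LangevinChainNESSProofs`). [folklore] -/
theorem hasDerivAt_V (ω₂ lam β γ r : ℝ) :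
    HasDerivAt (pinnedChain ω₂ lam β γ).V (r + β * r ^ 3) r := by
  have h : HasDerivAt (fun r : ℝ => r ^ 2 / 2 + β * r ^ 4 / 4)
      ((2 * r ^ 1 * 1) / 2 + β * (4 * r ^ 3 * 1) / 4) r :=
    (((hasDerivAt_id r).pow 2).div_const 2).add ((((hasDerivAt_id r).pow 4).const_mul β).div_const 4)
  have e : (2 * r ^ 1 * 1) / 2 + β * (4 * r ^ 3 * 1) / 4 = r + β * r ^ 3 := by ring
  rw [e] at h
  exact h

end AmplitudeScaling

open AmplitudeScaling

section Dynamics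
variable (ω₂ lam β γ : ℝ)

/-- FORCE SCALING: `F^{lam,β}_i(s • σ) = s · F^{lam s²,β s²}_i(σ)` (`U'_{lam}(sq) = s U'_{lam s²}(q)`,
`V'_β(sr) = s V'_{β s²}(r)`). [cite: AokiLukkarinenSpohn2006, §2 eqs. (2.8)-(2.10)] -/
theorem force_smul (s : ℝ) (σ : ChainConfig) (i : ℤ) :
    (pinnedChain ω₂ lam β γ).force (s • σ) i =
      s * (pinnedChain ω₂ (lam * s ^ 2) (β * s ^ 2) γ).force σ i := by
  simp only [OscillatorChain.force, OscillatorChain.interactionForce, (hasDerivAt_U _ _ _ _ _).deriv,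
    (hasDerivAt_V _ _ _ _ _).deriv, Pi.smul_apply, Prod.smul_fst, smul_eq_mul]
  ring

/-- SOLUTIONS SCALE (forward): if `c` solves the `(lam s², β s²)` equations then `t ↦ s • c t`
solves the `(lam, β)` equations. [cite: AokiLukkarinenSpohn2006, §2 eq. (2.8)] -/
theorem isSolution_smul {s : ℝ} {c : ℝ → ChainConfig}
    (hc : (pinnedChain ω₂ (lam * s ^ 2) (β * s ^ 2) γ).IsSolution c) :
    (pinnedChain ω₂ lam β γ).IsSolution fun t => s • c t := by
  intro i t
  obtain ⟨h1, h2⟩ := hc i t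
  refine ⟨?_, ?_⟩
  · simpa only [Pi.smul_apply, Prod.smul_fst, Prod.smul_snd, smul_eq_mul] using h1.const_mul s
  · have h2' := h2.const_mul s
    rw [← force_smul] at h2'
    simpa only [Pi.smul_apply, Prod.smul_snd, smul_eq_mul] using h2'

/-- SOLUTIONS SCALE (iff, `s ≠ 0`). [cite: AokiLukkarinenSpohn2006, §2 eq. (2.8)] -/
theorem isSolution_smul_iff {s : ℝ} (hs : s ≠ 0) (c : ℝ → ChainConfig) :
    (pinnedChain ω₂ lam β γ).IsSolution (fun t => s • c t) ↔
      (pinnedChain ω₂ (lam * s ^ 2) (β * s ^ 2) γ).IsSolution c := by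
  refine ⟨fun h => ?_, isSolution_smul ω₂ lam β γ⟩
  have key := isSolution_smul ω₂ (lam * s ^ 2) (β * s ^ 2) γ (s := s⁻¹) (c := fun t => s • c t)
  have e1 : lam * s ^ 2 * s⁻¹ ^ 2 = lam := by field_simp
  have e2 : β * s ^ 2 * s⁻¹ ^ 2 = β := by field_simp
  rw [e1, e2] at key
  simpa only [inv_smul_smul₀ hs] using key h

/-- **DYNAMICS CONJUGATE.** An infinite-volume dynamics of the rescaled chain
`pinnedChain ω₂ (lam s²) (β s²) γ` transports along `σ ↦ s • σ` to one of `pinnedChain ω₂ lam β γ`: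
carrier `S_s '' carrier`, flow `S_s ∘ φ_t ∘ S_s⁻¹`; the uniqueness field transports because
`S_s⁻¹` maps solutions staying in the image carrier to solutions staying in the carrier.
[cite: AokiLukkarinenSpohn2006, §2 eqs. (2.8)-(2.10)] -/
def smulDynamics {s : ℝ} (hs : s ≠ 0)
    (D : InfiniteChainDynamics (pinnedChain ω₂ (lam * s ^ 2) (β * s ^ 2) γ)) :
    InfiniteChainDynamics (pinnedChain ω₂ lam β γ) where
  carrier := (fun σ => s • σ) '' D.carrier
  flow := fun t σ => s • D.flow t (s⁻¹ • σ)
  mapsTo := by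
    rintro t _ ⟨σ, hσ, rfl⟩
    exact ⟨D.flow t σ, D.mapsTo t hσ, by simp only [inv_smul_smul₀ hs]⟩
  flow_zero := by
    rintro _ ⟨σ, hσ, rfl⟩
    rw [inv_smul_smul₀ hs, D.flow_zero σ hσ]
  isSolution := by
    rintro _ ⟨σ, hσ, rfl⟩
    simp only [inv_smul_smul₀ hs]
    exact isSolution_smul ω₂ lam β γ (D.isSolution σ hσ)
  unique := by
    intro c hc hsol t
    have hc' : ∀ u, s⁻¹ • c u ∈ D.carrier := by
      intro u
      obtain ⟨σ, hσ, hσc⟩ := hc u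
      rw [← hσc, inv_smul_smul₀ hs]
      exact hσ
    have hsol' : (pinnedChain ω₂ (lam * s ^ 2) (β * s ^ 2) γ).IsSolution fun u => s⁻¹ • c u := by
      rw [← isSolution_smul_iff ω₂ lam β γ hs]
      simpa only [smul_inv_smul₀ hs] using hsol
    have h : s⁻¹ • c t = D.flow t (s⁻¹ • c 0) := D.unique (fun u => s⁻¹ • c u) hc' hsol' t
    rw [← h, smul_inv_smul₀ hs]

/-- The transported flow, unfolded. [folklore] -/
@[simp] theorem smulDynamics_flow {s : ℝ} (hs : s ≠ 0)
    (D : InfiniteChainDynamics (pinnedChain ω₂ (lam * s ^ 2) (β * s ^ 2) γ)) (t : ℝ)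
    (σ : ChainConfig) : (smulDynamics ω₂ lam β γ hs D).flow t σ = s • D.flow t (s⁻¹ • σ) := rfl

/-- The transported carrier, unfolded. [folklore] -/
@[simp] theorem smulDynamics_carrier {s : ℝ} (hs : s ≠ 0)
    (D : InfiniteChainDynamics (pinnedChain ω₂ (lam * s ^ 2) (β * s ^ 2) γ)) :
    (smulDynamics ω₂ lam β γ hs D).carrier = (fun σ => s • σ) '' D.carrier := rfl

/-- The transported flow is `S_s ∘ φ_t ∘ S_s⁻¹` as a composition of maps. [folklore] -/
theorem smulDynamics_flow_eq_comp {s : ℝ} (hs : s ≠ 0)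
    (D : InfiniteChainDynamics (pinnedChain ω₂ (lam * s ^ 2) (β * s ^ 2) γ)) (t : ℝ) :
    (smulDynamics ω₂ lam β γ hs D).flow t = dilEquiv hs ∘ D.flow t ∘ (dilEquiv hs).symm := by
  funext σ
  simp only [smulDynamics_flow, Function.comp_apply, dilEquiv_apply, dilEquiv_symm_apply]

/-- CURRENT SCALING: `j^{β}_x(s • σ) = s² · j^{β s²}_x(σ)`. [cite: AokiLukkarinenSpohn2006, §2 eq. (2.11)] -/
theorem bondCurrentZ_smul (s : ℝ) (σ : ChainConfig) (x : ℤ) :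
    (pinnedChain ω₂ lam β γ).bondCurrentZ (s • σ) x =
      s ^ 2 * (pinnedChain ω₂ (lam * s ^ 2) (β * s ^ 2) γ).bondCurrentZ σ x := by
  simp only [OscillatorChain.bondCurrentZ, (hasDerivAt_V _ _ _ _ _).deriv, Pi.smul_apply,
    Prod.smul_fst, Prod.smul_snd, smul_eq_mul]
  ring

/-- The correlation integrand in the push-forward state is `s⁴` times the rescaled one. [folklore] -/
theorem correlationIntegrand_smul {s : ℝ} (hs : s ≠ 0)
    (D : InfiniteChainDynamics (pinnedChain ω₂ (lam * s ^ 2) (β * s ^ 2) γ)) (t : ℝ) (x : ℤ)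
    (σ : ChainConfig) :
    (pinnedChain ω₂ lam β γ).bondCurrentZ (s • σ) 0 *
        (pinnedChain ω₂ lam β γ).bondCurrentZ ((smulDynamics ω₂ lam β γ hs D).flow t (s • σ)) x =
      s ^ 4 * ((pinnedChain ω₂ (lam * s ^ 2) (β * s ^ 2) γ).bondCurrentZ σ 0 *
        (pinnedChain ω₂ (lam * s ^ 2) (β * s ^ 2) γ).bondCurrentZ (D.flow t σ) x) := by
  rw [smulDynamics_flow, inv_smul_smul₀ hs, bondCurrentZ_smul, bondCurrentZ_smul]
  ring

/-- **`C = s⁴ C'`**: the summed current autocorrelation of the transported dynamics in the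
push-forward state. [cite: AokiLukkarinenSpohn2006, §2 eqs. (2.11)-(2.12)] -/
theorem currentCorrelation_smulDynamics {s : ℝ} (hs : s ≠ 0)
    (D : InfiniteChainDynamics (pinnedChain ω₂ (lam * s ^ 2) (β * s ^ 2) γ))
    (μ : Measure ChainConfig) (t : ℝ) :
    (smulDynamics ω₂ lam β γ hs D).currentCorrelation (μ.map (dilEquiv hs)) t =
      s ^ 4 * D.currentCorrelation μ t := by
  simp only [InfiniteChainDynamics.currentCorrelation]
  rw [← tsum_mul_left]
  refine tsum_congr fun x => ?_
  rw [integral_map_equiv, ← integral_const_mul]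
  refine integral_congr_ae (Eventually.of_forall fun σ => ?_)
  simp only [dilEquiv_apply]
  exact correlationIntegrand_smul ω₂ lam β γ hs D t x σ

/-- Absolute convergence of the correlation sum is invariant. [folklore] -/
theorem hasAbsConvergentCorrelation_smulDynamics_iff {s : ℝ} (hs : s ≠ 0)
    (D : InfiniteChainDynamics (pinnedChain ω₂ (lam * s ^ 2) (β * s ^ 2) γ))
    (μ : Measure ChainConfig) (t : ℝ) :
    (smulDynamics ω₂ lam β γ hs D).HasAbsConvergentCorrelation (μ.map (dilEquiv hs)) t ↔
      D.HasAbsConvergentCorrelation μ t := by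
  have hs4 : s ^ 4 ≠ 0 := pow_ne_zero 4 hs
  have hint : ∀ x : ℤ,
      Integrable (fun σ => (pinnedChain ω₂ lam β γ).bondCurrentZ σ 0 *
          (pinnedChain ω₂ lam β γ).bondCurrentZ ((smulDynamics ω₂ lam β γ hs D).flow t σ) x)
          (μ.map (dilEquiv hs)) ↔
        Integrable (fun σ => (pinnedChain ω₂ (lam * s ^ 2) (β * s ^ 2) γ).bondCurrentZ σ 0 *
          (pinnedChain ω₂ (lam * s ^ 2) (β * s ^ 2) γ).bondCurrentZ (D.flow t σ) x) μ := by
    intro x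
    rw [integrable_map_equiv]
    have : ((fun σ => (pinnedChain ω₂ lam β γ).bondCurrentZ σ 0 *
          (pinnedChain ω₂ lam β γ).bondCurrentZ ((smulDynamics ω₂ lam β γ hs D).flow t σ) x) ∘
            (dilEquiv hs)) =
        fun σ => s ^ 4 * ((pinnedChain ω₂ (lam * s ^ 2) (β * s ^ 2) γ).bondCurrentZ σ 0 *
          (pinnedChain ω₂ (lam * s ^ 2) (β * s ^ 2) γ).bondCurrentZ (D.flow t σ) x) := by
      funext σ
      simp only [Function.comp_apply, dilEquiv_apply]
      exact correlationIntegrand_smul ω₂ lam β γ hs D t x σ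
    rw [this, integrable_const_mul_iff (isUnit_iff_ne_zero.mpr hs4)]
  have hterm : ∀ x : ℤ,
      ∫ σ, (pinnedChain ω₂ lam β γ).bondCurrentZ σ 0 *
          (pinnedChain ω₂ lam β γ).bondCurrentZ ((smulDynamics ω₂ lam β γ hs D).flow t σ) x
          ∂(μ.map (dilEquiv hs)) =
        s ^ 4 * ∫ σ, (pinnedChain ω₂ (lam * s ^ 2) (β * s ^ 2) γ).bondCurrentZ σ 0 *
          (pinnedChain ω₂ (lam * s ^ 2) (β * s ^ 2) γ).bondCurrentZ (D.flow t σ) x ∂μ := by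
    intro x
    rw [integral_map_equiv, ← integral_const_mul]
    refine integral_congr_ae (Eventually.of_forall fun σ => ?_)
    simp only [dilEquiv_apply]
    exact correlationIntegrand_smul ω₂ lam β γ hs D t x σ
  simp only [InfiniteChainDynamics.HasAbsConvergentCorrelation, hint, hterm, abs_mul]
  rw [summable_mul_left_iff (abs_ne_zero.mpr hs4)]

/-- Measure preservation transports: `μ ∘ S_s⁻¹` is preserved by the conjugated flow whenever
`μ` is preserved by the flow. [folklore] -/
theorem preservesMeasure_smulDynamics {s : ℝ} (hs : s ≠ 0)
    {D : InfiniteChainDynamics (pinnedChain ω₂ (lam * s ^ 2) (β * s ^ 2) γ)}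
    {μ : Measure ChainConfig} (h : D.PreservesMeasure μ) :
    (smulDynamics ω₂ lam β γ hs D).PreservesMeasure (μ.map (dilEquiv hs)) := by
  obtain ⟨hae, hmp⟩ := h
  refine ⟨?_, fun t => ?_⟩
  · rw [(dilEquiv hs).measurableEmbedding.ae_map_iff]
    filter_upwards [hae] with σ hσ
    exact ⟨σ, hσ, (dilEquiv_apply hs σ).symm⟩
  · rw [smulDynamics_flow_eq_comp]
    have h1 : MeasurePreserving (dilEquiv hs) μ (μ.map (dilEquiv hs)) :=
      ⟨(dilEquiv hs).measurable, rfl⟩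
    exact h1.comp ((hmp t).comp (MeasurableEquiv.measurePreserving_symm μ (dilEquiv hs)))

/-- Converse transport of measure preservation (apply the forward statement at `s⁻¹`). [folklore] -/
theorem preservesMeasure_smulDynamics_iff {s : ℝ} (hs : s ≠ 0)
    (D : InfiniteChainDynamics (pinnedChain ω₂ (lam * s ^ 2) (β * s ^ 2) γ))
    (μ : Measure ChainConfig) :
    (smulDynamics ω₂ lam β γ hs D).PreservesMeasure (μ.map (dilEquiv hs)) ↔ D.PreservesMeasure μ := by
  refine ⟨fun h => ?_, preservesMeasure_smulDynamics ω₂ lam β γ hs⟩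
  obtain ⟨hae, hmp⟩ := h
  refine ⟨?_, fun t => ?_⟩
  · rw [(dilEquiv hs).measurableEmbedding.ae_map_iff] at hae
    filter_upwards [hae] with σ hσ
    obtain ⟨σ', hσ', he⟩ := hσ
    rw [dilEquiv_apply] at he
    have : σ' = σ := smul_right_injective ChainConfig hs he
    exact this ▸ hσ'
  · have h1 : MeasurePreserving (dilEquiv hs) μ (μ.map (dilEquiv hs)) :=
      ⟨(dilEquiv hs).measurable, rfl⟩
    have h2 := ((MeasurableEquiv.measurePreserving_symm μ (dilEquiv hs)).comp (hmp t)).comp h1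
    rw [smulDynamics_flow_eq_comp] at h2
    convert h2 using 1
    funext σ
    simp only [Function.comp_apply, MeasurableEquiv.symm_apply_apply]

/-- ABEL FUNCTIONAL: `((s²T)²)⁻¹ ∫₀^∞ e^{-νt} C(t) dt = (T²)⁻¹ ∫₀^∞ e^{-νt} C'(t) dt` — the
`T⁻²`-normalised Abel-regularised Green–Kubo functional is INVARIANT (same value, hence same limit
`κ`). [cite: AokiLukkarinenSpohn2006, §2 eq. (2.12)] -/
theorem abelFunctional_smul {s : ℝ} (hs : s ≠ 0)
    (D : InfiniteChainDynamics (pinnedChain ω₂ (lam * s ^ 2) (β * s ^ 2) γ))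
    (μ : Measure ChainConfig) (T ν : ℝ) :
    ((s ^ 2 * T) ^ 2)⁻¹ * ∫ t in Ioi (0 : ℝ), Real.exp (-(ν * t)) *
        (smulDynamics ω₂ lam β γ hs D).currentCorrelation (μ.map (dilEquiv hs)) t =
      (T ^ 2)⁻¹ * ∫ t in Ioi (0 : ℝ), Real.exp (-(ν * t)) * D.currentCorrelation μ t := by
  simp only [currentCorrelation_smulDynamics]
  have : (fun t => Real.exp (-(ν * t)) * (s ^ 4 * D.currentCorrelation μ t)) =
      fun t => s ^ 4 * (Real.exp (-(ν * t)) * D.currentCorrelation μ t) := by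
    funext t; ring
  rw [this, integral_const_mul, ← mul_assoc]
  congr 1
  by_cases hT : T = 0
  · simp [hT]
  · field_simp

/-- GREEN–KUBO CONDUCTIVITY is invariant: `κ_GK^{lam,β}(s²T) = κ_GK^{lam s²,β s²}(T)` for the
conjugated pair. [cite: AokiLukkarinenSpohn2006, §2 eq. (2.12)] -/
theorem greenKuboConductivity_smulDynamics {s : ℝ} (hs : s ≠ 0)
    (D : InfiniteChainDynamics (pinnedChain ω₂ (lam * s ^ 2) (β * s ^ 2) γ))
    (μ : Measure ChainConfig) (T : ℝ) :
    (smulDynamics ω₂ lam β γ hs D).greenKuboConductivity (μ.map (dilEquiv hs)) (s ^ 2 * T) =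
      D.greenKuboConductivity μ T := by
  have h := abelFunctional_smul ω₂ lam β γ hs D μ T 0
  simpa only [InfiniteChainDynamics.greenKuboConductivity, zero_mul, neg_zero, Real.exp_zero,
    one_mul] using h

/-- `HasGreenKubo` is invariant under the conjugacy. [cite: AokiLukkarinenSpohn2006, §2 eq. (2.13)] -/
theorem hasGreenKubo_smulDynamics_iff {s : ℝ} (hs : s ≠ 0)
    (D : InfiniteChainDynamics (pinnedChain ω₂ (lam * s ^ 2) (β * s ^ 2) γ))
    (μ : Measure ChainConfig) (T : ℝ) :
    (smulDynamics ω₂ lam β γ hs D).HasGreenKubo (μ.map (dilEquiv hs)) (s ^ 2 * T) ↔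
      D.HasGreenKubo μ T := by
  have hs4 : s ^ 4 ≠ 0 := pow_ne_zero 4 hs
  simp only [InfiniteChainDynamics.HasGreenKubo, hasAbsConvergentCorrelation_smulDynamics_iff,
    greenKuboConductivity_smulDynamics]
  have hC : (smulDynamics ω₂ lam β γ hs D).currentCorrelation (μ.map (dilEquiv hs)) =
      fun t => s ^ 4 * D.currentCorrelation μ t := by
    funext t; exact currentCorrelation_smulDynamics ω₂ lam β γ hs D μ t
  rw [hC]
  constructor
  · rintro ⟨h1, h2, h3⟩
    exact ⟨h1, (integrable_const_mul_iff (isUnit_iff_ne_zero.mpr hs4) _).1 h2, h3⟩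
  · rintro ⟨h1, h2, h3⟩
    exact ⟨h1, h2.const_mul _, h3⟩

end Dynamics

/-! ### Existence-level corollaries: low temperature is weak anharmonicity -/

section UnitTemperature
variable (ω₂ lam β γ : ℝ)

/-- **ABELIAN GREEN–KUBO WITNESSES TRANSPORT** (forward, general `s ≠ 0`): a witness of the
`(lam s², β s²)` chain at `T` (Gibbs state, preserving dynamics with absolutely convergent
correlations, `κ > 0` Abel limit of `T⁻²∫e^{-νt}C`) yields a witness of the `(lam, β)` chain at
`s²T` with the SAME `κ`. [cite: AokiLukkarinenSpohn2006, §2 eqs. (2.12)-(2.13)] -/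
theorem abelWitness_transport {s : ℝ} (hs : s ≠ 0) {T : ℝ}
    (h : ∃ (μ : Measure ChainConfig)
      (D : InfiniteChainDynamics (pinnedChain ω₂ (lam * s ^ 2) (β * s ^ 2) γ)) (κ : ℝ),
      (pinnedChain ω₂ (lam * s ^ 2) (β * s ^ 2) γ).IsChainGibbsMeasure T μ ∧ D.PreservesMeasure μ ∧
        (∀ t : ℝ, D.HasAbsConvergentCorrelation μ t) ∧ 0 < κ ∧
          Tendsto (fun ν : ℝ => (T ^ 2)⁻¹ * ∫ t in Ioi (0 : ℝ),
            Real.exp (-(ν * t)) * D.currentCorrelation μ t) (𝓝[>] (0 : ℝ)) (𝓝 κ)) :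
    ∃ (μ : Measure ChainConfig) (D : InfiniteChainDynamics (pinnedChain ω₂ lam β γ)) (κ : ℝ),
      (pinnedChain ω₂ lam β γ).IsChainGibbsMeasure (s ^ 2 * T) μ ∧ D.PreservesMeasure μ ∧
        (∀ t : ℝ, D.HasAbsConvergentCorrelation μ t) ∧ 0 < κ ∧
          Tendsto (fun ν : ℝ => ((s ^ 2 * T) ^ 2)⁻¹ * ∫ t in Ioi (0 : ℝ),
            Real.exp (-(ν * t)) * D.currentCorrelation μ t) (𝓝[>] (0 : ℝ)) (𝓝 κ) := by
  obtain ⟨μ, D, κ, hG, hP, hAC, hκ, hlim⟩ := h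
  refine ⟨μ.map (dilEquiv hs), smulDynamics ω₂ lam β γ hs D, κ,
    isChainGibbsMeasure_map_dil ω₂ lam β γ hs hG, preservesMeasure_smulDynamics ω₂ lam β γ hs hP,
    fun t => (hasAbsConvergentCorrelation_smulDynamics_iff ω₂ lam β γ hs D μ t).2 (hAC t), hκ, ?_⟩
  simp only [abelFunctional_smul]
  exact hlim

/-- **LOW TEMPERATURE IS WEAK ANHARMONICITY (Abelian Green–Kubo witnesses).** For `T > 0`, an
Abelian Green–Kubo witness of `pinnedChain ω₂ lam β γ` at temperature `T` exists iff one of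
`pinnedChain ω₂ (lam T) (β T) γ` at temperature `1` exists (same `κ`). This is the witness
predicate of `EmbeddedDrudeMourre.GreenKuboContinuation` / `AbelThermodynamicLimit`
(stmt-AtomisticToContinuum-12597 / 12596). [cite: AokiLukkarinenSpohn2006, §2 eq. (2.13)] -/
theorem exists_abelWitness_iff_unit_temp {T : ℝ} (hT : 0 < T) :
    (∃ (μ : Measure ChainConfig) (D : InfiniteChainDynamics (pinnedChain ω₂ lam β γ)) (κ : ℝ),
      (pinnedChain ω₂ lam β γ).IsChainGibbsMeasure T μ ∧ D.PreservesMeasure μ ∧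
        (∀ t : ℝ, D.HasAbsConvergentCorrelation μ t) ∧ 0 < κ ∧
          Tendsto (fun ν : ℝ => (T ^ 2)⁻¹ * ∫ t in Ioi (0 : ℝ),
            Real.exp (-(ν * t)) * D.currentCorrelation μ t) (𝓝[>] (0 : ℝ)) (𝓝 κ)) ↔
    (∃ (μ : Measure ChainConfig) (D : InfiniteChainDynamics (pinnedChain ω₂ (lam * T) (β * T) γ))
      (κ : ℝ),
      (pinnedChain ω₂ (lam * T) (β * T) γ).IsChainGibbsMeasure 1 μ ∧ D.PreservesMeasure μ ∧
        (∀ t : ℝ, D.HasAbsConvergentCorrelation μ t) ∧ 0 < κ ∧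
          Tendsto (fun ν : ℝ => ((1 : ℝ) ^ 2)⁻¹ * ∫ t in Ioi (0 : ℝ),
            Real.exp (-(ν * t)) * D.currentCorrelation μ t) (𝓝[>] (0 : ℝ)) (𝓝 κ)) := by
  have hs : Real.sqrt T ≠ 0 := (Real.sqrt_pos.mpr hT).ne'
  have hs2 : Real.sqrt T ^ 2 = T := Real.sq_sqrt hT.le
  constructor
  · intro h
    -- go down with s⁻¹ from (lam, β; T) = ((lam T)(s⁻¹)², (β T)(s⁻¹)²; T) to (lam T, β T; (s⁻¹)² T = 1)
    have key := abelWitness_transport ω₂ (lam * T) (β * T) γ (inv_ne_zero hs) (T := T)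
    have e1 : lam * T * (Real.sqrt T)⁻¹ ^ 2 = lam := by rw [inv_pow, hs2]; field_simp
    have e2 : β * T * (Real.sqrt T)⁻¹ ^ 2 = β := by rw [inv_pow, hs2]; field_simp
    have e3 : (Real.sqrt T)⁻¹ ^ 2 * T = 1 := by rw [inv_pow, hs2]; field_simp
    rw [e1, e2, e3] at key
    exact key h
  · intro h
    have key := abelWitness_transport ω₂ lam β γ hs (T := 1)
    rw [hs2, mul_one] at key
    exact key h

/-- **LOW TEMPERATURE IS WEAK ANHARMONICITY (Green–Kubo pairs, stmt-0703's clause).** For `T > 0`,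
`pinnedChain ω₂ lam β γ` has a Gibbs state with a preserving dynamics satisfying `HasGreenKubo`
at `T` iff `pinnedChain ω₂ (lam T) (β T) γ` has one at temperature `1`.
[cite: AokiLukkarinenSpohn2006, §2 eq. (2.13)] -/
theorem exists_hasGreenKubo_iff_unit_temp {T : ℝ} (hT : 0 < T) :
    (∃ μ : Measure ChainConfig, (pinnedChain ω₂ lam β γ).IsChainGibbsMeasure T μ ∧
      ∃ D : InfiniteChainDynamics (pinnedChain ω₂ lam β γ), D.PreservesMeasure μ ∧ D.HasGreenKubo μ T) ↔
    (∃ μ : Measure ChainConfig, (pinnedChain ω₂ (lam * T) (β * T) γ).IsChainGibbsMeasure 1 μ ∧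
      ∃ D : InfiniteChainDynamics (pinnedChain ω₂ (lam * T) (β * T) γ),
        D.PreservesMeasure μ ∧ D.HasGreenKubo μ 1) := by
  have hs : Real.sqrt T ≠ 0 := (Real.sqrt_pos.mpr hT).ne'
  have hs2 : Real.sqrt T ^ 2 = T := Real.sq_sqrt hT.le
  -- forward transport at a general scale
  have fwd : ∀ (l b s : ℝ) (hs : s ≠ 0) (S : ℝ),
      (∃ μ : Measure ChainConfig, (pinnedChain ω₂ (l * s ^ 2) (b * s ^ 2) γ).IsChainGibbsMeasure S μ ∧
        ∃ D : InfiniteChainDynamics (pinnedChain ω₂ (l * s ^ 2) (b * s ^ 2) γ),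
          D.PreservesMeasure μ ∧ D.HasGreenKubo μ S) →
      (∃ μ : Measure ChainConfig, (pinnedChain ω₂ l b γ).IsChainGibbsMeasure (s ^ 2 * S) μ ∧
        ∃ D : InfiniteChainDynamics (pinnedChain ω₂ l b γ),
          D.PreservesMeasure μ ∧ D.HasGreenKubo μ (s ^ 2 * S)) := by
    rintro l b s hs S ⟨μ, hG, D, hP, hGK⟩
    exact ⟨μ.map (dilEquiv hs), isChainGibbsMeasure_map_dil ω₂ l b γ hs hG, smulDynamics ω₂ l b γ hs D,
      preservesMeasure_smulDynamics ω₂ l b γ hs hP,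
      (hasGreenKubo_smulDynamics_iff ω₂ l b γ hs D μ S).2 hGK⟩
  constructor
  · intro h
    have key := fwd (lam * T) (β * T) (Real.sqrt T)⁻¹ (inv_ne_zero hs) T
    have e1 : lam * T * (Real.sqrt T)⁻¹ ^ 2 = lam := by rw [inv_pow, hs2]; field_simp
    have e2 : β * T * (Real.sqrt T)⁻¹ ^ 2 = β := by rw [inv_pow, hs2]; field_simp
    have e3 : (Real.sqrt T)⁻¹ ^ 2 * T = 1 := by rw [inv_pow, hs2]; field_simp
    rw [e1, e2, e3] at key
    exact key h
  · intro h
    have key := fwd lam β (Real.sqrt T) hs 1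
    rw [hs2, mul_one] at key
    exact key h

end UnitTemperature

end Literature.MathematicalPhysics.KineticTheory.HeatConduction

end
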